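import Literature.NumberTheory.Automorphic.NewformArchParameterProofs
import Literature.NumberTheory.Automorphic.CDTTheorem722
import HarnessLib

/-!
# The weight-zero cuspidal automorphic representation of a modular elliptic curve over `ℚ`

Topic `Literature/NumberTheory/Automorphic`; a *proofs* file (theorems only: no definition, no
named fact, no instance), first brick of the discharge programme of
`Literature.NumberTheory.Automorphic.isModularEllipticCurve_baseChange_rat_of_isSolvable`
(`SolvableBaseChangeModularity`: modularity of `E₀ ⊗ K` over solvable totally real `K`, printed
as "BCDT Thm. A + Langlands' cyclic base change", Thorne 2016 Lemma 7.1 with `F = ℚ`).  Its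
ground floor is the passage from the classical Modularity Theorem to the automorphic carrier on
which the tree's base-change facts (`baseChange_cyclic_cuspidal`,
`ArthurClozel1989_strongLifting_archimedean`) and the conclusion `IsModularEllipticCurve` live:

* `exists_hasWeightZero_satake_of_isNewformOf` — **for an elliptic `W / ℚ` with newform
  `f ∈ S₂(Γ₀(N))` (`IsNewformOf W f`) there is a cuspidal automorphic representation `π` of
  `GL₂(𝔸_ℚ)` (Borel–Jacquet datum, `CuspidalAutomorphicRepData 2 ℚ hcpt`) of weight zero
  (`HasWeightZero`) whose Satake parameter `{α₁, α₂}` at all but finitely many `p` satisfies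
  `(X - √p α₁)(X - √p α₂) = X² - a_p(W) X + p`** (`a_p(W) = WeierstrassCurve.frobeniusTraceAt`;
  the shape of the `π`-clause of `WeierstrassCurve.IsCuspidalTateAutomorphic`);
* `exists_hasWeightZero_satake_of_exists_isNewformOf` — the same for every elliptic `W / ℚ`,
  granted `exists_isNewformOf` (BCDT Thm. A).

Everything is assembled from theorems of the tree: the `Γ₁(N)`-lift of `f` is a newform with
trivial nebentypus (`isNewform1_liftToGamma1_iff_holds`, `nebentypus_liftToGamma1_holds`, Li 1975);
Gelbart's dictionary `f ↦ π_f` with its unitary Satake pairs `X² - a_p p^{-1/2} X + χ(p)` and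
archimedean parameter `{1/2, -1/2}` (`exists_cuspidalAutomorphicRepData_newform`,
`NewformArchParameterProofs`; Gelbart 1997, Prop. 2.5 (b), (c), (2.5.1), Remark 2.5.2), the latter
being the weight-zero infinity type of `GL₂ / ℚ` (`map_a_weightZeroInfinityType_two`); and
`a_p(f₁) = a_p(f) = a_p(W)` (`IsNewform1.heckeEigenvalue_eq_coeff_holds`,
`coe_liftToGamma1_holds`, `IsNewformOf`, `lFunction_primesEquiv_eq_frobeniusTraceAt` at the places
of good reduction, Diamond–Shurman (8.44)); the renormalisation `α ↦ √p α` is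
`prod_X_sub_C_sqrt_mul_of_satakePolynomial_eq`.

## References

* S. Gelbart, *Three lectures on the modularity of `ρ̄_{E,3}` and the Langlands reciprocity
  conjecture*, in *Modular Forms and Fermat's Last Theorem* (1997), §2.5, Proposition (b), (c),
  (2.5.1), Remark 2.5.2. [Gelbart1997]
* C. Breuil, B. Conrad, F. Diamond, R. Taylor, J. Amer. Math. Soc. 14 (2001), Thm. A.
  [BCDTJAMS2001]
* F. Diamond, J. Shurman, *A First Course in Modular Forms* (2005), Thm. 8.8.3, §8.8 (8.44),
  §5.1 (p. 166). [DiamondShurman2005]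
* W.-C. W. Li, *Newforms and functional equations*, Math. Ann. 212 (1975), §3. [Li1975]
* L. Clozel, *Motifs et formes automorphes* (1990), §3.5 (weight zero). [Clozel1990]
-/

noncomputable section

open scoped MatrixGroups NumberField Polynomial ModularForm
open NumberField IsDedekindDomain Filter Polynomial CongruenceSubgroup

namespace Literature.NumberTheory.Automorphic

open EllipticCurves.ModularForms Rat.HeightOneSpectrum IsDedekindDomain.HeightOneSpectrum
  WeierstrassCurve

/-- The archimedean parameter `{(k-1)/2, (1-k)/2}` of a weight-`2` eigenform is the `a`-multiset
`{ρ₀, ρ₁} = {1/2, -1/2}` of the weight-zero infinity type of `GL₂ / ℚ`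
(`weightZeroInfinityType`, Clozel 1990, §3.5). [folklore] -/
theorem map_a_weightZeroInfinityType_two (σ : ℚ →+* ℂ) :
    (weightZeroInfinityType 2 ℚ σ).map ArchWeight.a =
      ({(((2 : ℤ) : ℂ) - 1) / 2, (1 - ((2 : ℤ) : ℂ)) / 2} : Multiset ℂ) := by
  simp only [weightZeroInfinityType_apply, Multiset.map_map, Function.comp_def,
    weightZeroArchWeight_a]
  rw [Fin.univ_val_map]
  simp [rhoGL]
  norm_num
  rfl


/-- From the unitary Satake pair `{α, β}` of a weight-`2` eigenform with trivial character at
`p` — `(X - α)(X - β) = X² - (a_p/√p) X + 1` — to the arithmetic normalisation: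
`(X - √p α)(X - √p β) = X² - a_p X + p`. [folklore] -/
theorem prod_X_sub_C_sqrt_mul_of_satakePolynomial_eq {α : Multiset ℂ} (hcard : Multiset.card α = 2)
    {p : ℕ} (hp : p ≠ 0) {a : ℂ}
    (h : satakePolynomial α =
      X ^ 2 - C (a * (((Real.sqrt (p : ℝ)) : ℝ) : ℂ) ^ (1 - (2 : ℤ))) * X + C 1) :
    (α.map fun z => X - C ((((Real.sqrt (p : ℝ)) : ℝ) : ℂ) * z)).prod =
      X ^ 2 - C a * X + C (p : ℂ) := by
  obtain ⟨x, y, rfl⟩ := Multiset.card_eq_two.mp hcard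
  set s : ℂ := (((Real.sqrt (p : ℝ)) : ℝ) : ℂ) with hs
  have hs0 : s ≠ 0 := by
    rw [hs]; exact_mod_cast (Real.sqrt_pos.2 (Nat.cast_pos.2 (Nat.pos_of_ne_zero hp))).ne'
  have hs2 : s ^ 2 = (p : ℂ) := by
    rw [hs]; exact_mod_cast Real.sq_sqrt (Nat.cast_nonneg p)
  have hpoly : satakePolynomial {x, y} = X ^ 2 - C (x + y) * X + C (x * y) :=
    satakePolynomial_pair_eq_sq_sub x y
  rw [hpoly] at h
  have h1 := congrArg (fun P : ℂ[X] => P.coeff 1) h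
  have h0 := congrArg (fun P : ℂ[X] => P.coeff 0) h
  simp only [coeff_add, coeff_sub, coeff_C_mul, coeff_X_pow, coeff_X_one, coeff_C,
    if_neg (one_ne_zero), if_neg (show (1 : ℕ) ≠ 2 by decide)] at h1
  simp only [coeff_add, coeff_sub, coeff_C_mul, coeff_X_pow, coeff_X_zero, coeff_C_zero,
    if_neg (show (0 : ℕ) ≠ 2 by decide)] at h0
  have hsum : x + y = a * s ^ (1 - (2 : ℤ)) := by linear_combination -h1
  have hprod : x * y = 1 := by linear_combination h0
  have hzpow : s ^ (1 - (2 : ℤ)) = s⁻¹ := by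
    rw [show (1 - (2 : ℤ)) = -1 by norm_num, zpow_neg_one]
  rw [hzpow] at hsum
  simp only [Multiset.insert_eq_cons, Multiset.map_cons, Multiset.map_singleton,
    Multiset.prod_cons, Multiset.prod_singleton]
  have e1 : s * x + s * y = a := by
    rw [← mul_add, hsum]; field_simp
  have e2 : (s * x) * (s * y) = (p : ℂ) := by
    rw [show (s * x) * (s * y) = s ^ 2 * (x * y) by ring, hprod, mul_one, hs2]
  calc (X - C (s * x)) * (X - C (s * y))
      = X ^ 2 - C (s * x + s * y) * X + C ((s * x) * (s * y)) := by
        rw [map_add, map_mul (C : ℂ →+* ℂ[X]) (s * x) (s * y)]; ring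
    _ = X ^ 2 - C a * X + C (p : ℂ) := by rw [e1, e2]

/-- **The cuspidal automorphic representation of weight zero of a modular elliptic curve over
`ℚ`, with its Satake parameters.**  Let `W / ℚ` be an elliptic Weierstrass model and
`f ∈ S₂(Γ₀(N))` its newform (`IsNewformOf W f`: `aₙ(f) = aₙ(W)`).  Then for every witness
`hcpt` of the compactness fact typing the carrier there is a cuspidal automorphic representation
`π` of `GL₂(𝔸_ℚ)` (Borel–Jacquet datum) of weight zero (`HasWeightZero`) such that at all but
finitely many finite places `v` (those over `p ∤ N` of good reduction) `π_v` is unramified with a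
Satake parameter `α = {α₁, α₂}` satisfying `(X - √p α₁)(X - √p α₂) = X² - a_p(W) X + p`,
`a_p(W) = p + 1 - #W̃(𝔽_p)` (`WeierstrassCurve.frobeniusTraceAt`).  Proof: the lift
`f₁ ∈ S₂(Γ₁(N))` of `f` is a newform with trivial nebentypus (`isNewform1_liftToGamma1_iff_holds`,
`nebentypus_liftToGamma1_holds`, Li 1975); Gelbart's dictionary as proved in the tree
(`exists_cuspidalAutomorphicRepData_newform`: Gelbart 1997, Prop. 2.5 (b), (c), (2.5.1),
Remark 2.5.2) gives `π` with `∏_{a ∈ α}(X - a) = X² - a_p(f₁) p^{-1/2} X + 1` at `p ∤ N` and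
archimedean parameter `{1/2, -1/2}`, which is the weight-zero infinity type of `GL₂ / ℚ`
(`map_a_weightZeroInfinityType_two`); and `a_p(f₁) = a_p(f) = a_p(W)`
(`IsNewform1.heckeEigenvalue_eq_coeff_holds`, `coe_liftToGamma1_holds`, `IsNewformOf`,
`lFunction_primesEquiv_eq_frobeniusTraceAt` at the good `p`, Diamond–Shurman (8.44)).
[cite: Gelbart1997, §2.5 Proposition (b), (c), (2.5.1) and Remark 2.5.2]
[cite: DiamondShurman2005, Thm. 8.8.3 and §8.8 (8.44)] -/
theorem exists_hasWeightZero_satake_of_isNewformOf {N : ℕ} [NeZero N] (W : WeierstrassCurve ℚ)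
    [W.IsElliptic] {f : CuspForm (Gamma0 N) 2} (hf : IsNewformOf W f)
    (hcpt : isCompact_glFiniteIntegralLevel 2 ℚ) :
    ∃ π : CuspidalAutomorphicRepData 2 ℚ hcpt, π.1.HasWeightZero ∧
      ∀ᶠ v : HeightOneSpectrum (𝓞 ℚ) in cofinite, ∃ α : Multiset ℂ, π.1.HasSatakeParamAt v α ∧
        (α.map fun z => X - C ((((Real.sqrt (v.residueCard : ℝ)) : ℝ) : ℂ) * z)).prod =
          X ^ 2 - C ((W.frobeniusTraceAt v : ℤ) : ℂ) * X + C ((v.residueCard : ℕ) : ℂ) := by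
  classical
  have hfne : f ≠ 0 := BCDT.ne_zero_of_isNewformOf hf
  -- the newform on `Γ₁(N)` with trivial character
  set f₁ : CuspForm (Gamma1 N) 2 := liftToGamma1 N 2 f with hf₁
  have hnew : IsNewform1 f₁ := (isNewform1_liftToGamma1_iff_holds N 2 f).mpr hf.1
  have hcoe : (⇑f₁ : UpperHalfPlane → ℂ) = ⇑f := coe_liftToGamma1_holds N 2 f
  have hε : nebentypus f₁ = 1 := nebentypus_liftToGamma1_holds N 2 hfne
  -- Gelbart's dictionary
  obtain ⟨π, hsat, harch⟩ := exists_cuspidalAutomorphicRepData_newform (hcpt := hcpt) f₁ hnew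
  refine ⟨π, ⟨isWellFormed_weightZeroInfinityType 2 ℚ, ?_⟩, ?_⟩
  · -- weight zero: archimedean parameter `{1/2, -1/2}`
    have hχ : (fun σ : ℚ →+* ℂ ↦ (weightZeroInfinityType 2 ℚ σ).map ArchWeight.a) =
        fun _ ↦ ({(((2 : ℤ) : ℂ) - 1) / 2, (1 - ((2 : ℤ) : ℂ)) / 2} : Multiset ℂ) := by
      funext σ
      exact map_a_weightZeroInfinityType_two σ
    rw [hχ]
    exact harch
  · -- Satake parameters at the places over `p ∤ N` of good reduction
    have hN : ∀ᶠ v : HeightOneSpectrum (𝓞 ℚ) in cofinite,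
        ¬ ((primesEquiv v : Nat.Primes) : ℕ) ∣ N := by
      have hfin : {v : HeightOneSpectrum (𝓞 ℚ) | ((primesEquiv v : Nat.Primes) : ℕ) ∣ N}.Finite := by
        refine ((Set.finite_Iic N).preimage
          (f := fun v : HeightOneSpectrum (𝓞 ℚ) ↦ ((primesEquiv v : Nat.Primes) : ℕ)) ?_).subset ?_
        · intro v _ w _ hvw
          exact primesEquiv.injective (Subtype.ext hvw)
        · intro v hv
          exact Nat.le_of_dvd (Nat.pos_of_ne_zero (NeZero.ne N)) hv
      exact hfin.compl_mem_cofinite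
    filter_upwards [hN, W.eventually_hasGoodReductionAt] with v hvN hgood
    obtain ⟨α, hα, hpol⟩ := hsat v hvN
    refine ⟨α, hα, ?_⟩
    have hpp : ((primesEquiv v : Nat.Primes) : ℕ).Prime := (primesEquiv v).2
    -- `a_p(f₁) = a_p(f) = a_p(W)`
    have ha : heckeEigenvalue f₁ ((primesEquiv v : Nat.Primes) : ℕ) =
        ((W.frobeniusTraceAt v : ℤ) : ℂ) := by
      rw [IsNewform1.heckeEigenvalue_eq_coeff_holds hnew hpp, hcoe]
      have h2 : cuspCoeff f ((primesEquiv v : Nat.Primes) : ℕ) = _ := hf.2 _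
      rw [cuspCoeff] at h2
      rw [h2, W.lFunction_primesEquiv_eq_frobeniusTraceAt hgood]
    -- trivial character at `p ∤ N`
    have hεp : nebentypus f₁ ((((primesEquiv v : Nat.Primes) : ℕ) : ℕ) : ZMod N) = 1 := by
      rw [hε, MulChar.one_apply ((ZMod.isUnit_prime_iff_not_dvd hpp).mpr hvN)]
    rw [ha, hεp] at hpol
    rw [residueCard_eq_primesEquiv]
    exact prod_X_sub_C_sqrt_mul_of_satakePolynomial_eq hα.card_eq hpp.ne_zero hpol


/-- **Every elliptic curve over `ℚ` is automorphic of weight zero, granted the Modularity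
Theorem** (Breuil–Conrad–Diamond–Taylor 2001, Thm. A, in the tree's form
`exists_isNewformOf`, Diamond–Shurman Thm. 8.8.3): for every elliptic `W / ℚ` there is a
weight-zero cuspidal `π` on `GL₂(𝔸_ℚ)` whose Satake parameter `{α₁, α₂}` at all but finitely many
`p` satisfies `(X - √p α₁)(X - √p α₂) = X² - a_p(W) X + p`
(`exists_hasWeightZero_satake_of_isNewformOf` for the newform of `W`, the conductor instance by
`conductorNorm_pos_holds`). [cite: BCDTJAMS2001, Theorem A] [cite: DiamondShurman2005, Thm. 8.8.3] -/
theorem exists_hasWeightZero_satake_of_exists_isNewformOf (hA : exists_isNewformOf)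
    (W : WeierstrassCurve ℚ) [W.IsElliptic] (hcpt : isCompact_glFiniteIntegralLevel 2 ℚ) :
    ∃ π : CuspidalAutomorphicRepData 2 ℚ hcpt, π.1.HasWeightZero ∧
      ∀ᶠ v : HeightOneSpectrum (𝓞 ℚ) in cofinite, ∃ α : Multiset ℂ, π.1.HasSatakeParamAt v α ∧
        (α.map fun z => X - C ((((Real.sqrt (v.residueCard : ℝ)) : ℝ) : ℂ) * z)).prod =
          X ^ 2 - C ((W.frobeniusTraceAt v : ℤ) : ℂ) * X + C ((v.residueCard : ℕ) : ℂ) := by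
  haveI : NeZero (W.conductorNorm ℤ) := ⟨(conductorNorm_pos_holds W).ne'⟩
  obtain ⟨f, hf⟩ := hA W
  exact exists_hasWeightZero_satake_of_isNewformOf W hf hcpt

end Literature.NumberTheory.Automorphic
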